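import Summits.QuantumFields.YangMills.Theorems.BalabanUVNodesN12RootTransporterBjLocal
import Literature.MathematicalPhysics.QuantumFieldTheory.Balaban1983to89.Node00.MultiScaleFibreChartB
import HarnessLib

/-!
# BalabanUVNodes ∕ N12 — THE ROOT-TRANSPORTER LETTER WITH A LOCAL MEMBER-AVERAGE LETTER: the chains of `N12BjRootChains(Graded)` read the member averages `M^i(U)(c)` only at their own links, — **BOND-DATUM EDITION** (`…N12RootTransporterBjLocalB`, USED DECLARATIONS ONLY)

The print-datum ([Balaban1984PropagatorsII] (2.3)) (γ) twin of `Summits/…/Theorems/BalabanUVNodesN12RootTransporterBjLocal.lean`: the declarations of the parent whose STATEMENT reads the determining datum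
(`transporter_of_links_local`) and which N12's junction of record v14ᴸ uses (dag-n12-c g35 probe-2 census `UsedConstsN12RoadTyped2`, THEOREMS block), re-typed over a
BOND-LEVEL datum `𝔅 : BDetSet` (F0a `B15DeterminingSetsB`) and dag-n12-c's bond-datum chart `Node00.msChartB` (✓p774329; `msChart 𝐁 = msChartB (bondsDet 𝐁)` by `rfl`).  GENERATOR twin
(this seat's `work/g32/gen_thm.py`, block-extracted from the parent's tree bytes): namespace `…N12RootTransporterBjLocalB`, SAME short names, `DetSet ↦ BDetSet`, `AgreeOn 𝐁 ↦ AgreeOnB 𝔅`,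
`IsMinimizer ↦ IsMinimizerB`, `bondsOf (𝐁 j) ↦ 𝔅 j`, `msChart ∕ constrCard ∕ constrEnum ∕ ConstrSet ↦ …B`, NODE 00 chart lemmas `…msChart… ↦ …msChartB…`; proofs VERBATIM; the parent's
datum-free declarations REUSED BY NAME (`open`), never copied (private plumbing excepted, №366 R2).  The parent's (b) statements are the instances `𝔅 := bondsDet 𝐁`.

Cell `pub-ymgap` (HUMAN RULINGS D-0062 ∕ D-0149), seat `pub-ymgap-dag-n12-d` g32 (R134 N12 [B15] s2; the (ii) Theorems-side re-key of N12's road at print's [II] (2.3) datum — director-ym №338 ∕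
№343 (E1)(iii-b), FLAG №16 ∕ ruling (α); dag-n12-c DESIGN memo a793b2ebc0b803bf (ii); `N12-ROAD-TWIN-ORDER-2026-08-30.md`).  Count-neutral helper of K1⁹ `stmt-QuantumFields-27364`,
`--kind proof --supports … --as helper`.  THEOREMS ONLY (0 `def`, 0 `instance`, 0 `sorry`).

HONEST FRAMING (director-ym №338 (5)).  PURELY ADDITIVE: the parent stays landed and true on its own text; nothing in it is edited; no displayed premise of any consumer is deleted or
weakened; every hypothesis of the parent stays a hypothesis.  Nothing of Bałaban's analysis asserted; N12 NOT discharged; K0⁷ ∕ K1⁹ NOT closed; counts unmoved (typed 28∕28 · discharged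
8∕27, A 8∕28; K 1∕4); one finite 𝕋⁴ programme at fixed ε — R4 closes the conditional rung `BalabanLadder.UV` only; NOT the Yang–Mills mass gap (Clay); nothing continuum ∕ ℝ⁴ ∕ OS.

PARENT's DOCSTRING (the mathematics and the citations; read the site-level `𝐁` as the bond datum `𝔅`):
# BalabanUVNodes ∕ N12 — THE ROOT-TRANSPORTER LETTER WITH A LOCAL MEMBER-AVERAGE LETTER: the chains of `N12BjRootChains(Graded)` read the member averages `M^i(U)(c)` only at their own links,
# and every link has a segment end `walkEnd (root b₋) w`, `|w| ≤ m·L^k` (consecutiveness) — so the letter `dist1 (M^i(U)(c)) ≤ δ₁` is needed only for members within walk-distance `m·L^k` of a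
# root, not for all of `bondsOf 𝐁_k(Z)_i` (whose level `0` is `bondsOf (Ω₁ᶜ)`, global)

Cell `pub-ymgap` (HUMAN RULINGS D-0062 ∕ D-0149), WIDTH SEAT `pub-ymgap-dag-n12-w3` g4 (node N12 = [B15]; key K1⁹ `stmt-QuantumFields-27364` (KEY MAP v2), `--kind proof --supports … --as
helper`; count-neutral).  THEOREMS ONLY (0 `def`, 0 `instance`, 0 `sorry`).

WHY (honest flag, cell bus 2026-08-28 ≈17:58Z).  `N12RootTransporterBj.transporter_of_links` ∕ `rootTransporter_Bj(_graded)` display the member-average letter for ALL members of `𝐁_k(Z)`; at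
level `0` these are all bonds meeting `Ω₁ᶜ` — far from `Z` the datum `Q_k^{s*}W` there is a bare `k`-bond variable, not near `1`, so the global premise is uninhabitable in the intended
instantiation (dag-n12-w5's (vii): `W = ext Vk`).  The proofs only ever read the LINKS of the chain; THIS FILE restates both theorems with the LOCAL premise: ★★ `transporter_of_links_local`
(members with a segment end `= walkEnd r w`, `|w| ≤ Rloc`, `Rloc ≥ (#links)·L^N`; the witness is the flattened prefix, by `hcons`), ★★★ `rootTransporter_Bj_graded_local` (members reachable
from `root x`, `x ∈ Ω₁(Z)`, within `m·L^k`).  The record editions and the capstones follow in `…GaugeLetterLocAtRecordLocal` ∕ `…OfPlaqSmallLocal`.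

HONEST FRAMING.  Word bookkeeping + the two proofs of `N12RootTransporterBj` with one premise weakened; nothing of Bałaban's asserted; count-neutral; N12 NOT discharged; K1⁹ NOT closed; counts
unmoved (typed 28∕28 · discharged 5∕27); one finite 𝕋⁴ programme at fixed ε — R4 closes the conditional rung `BalabanLadder.UV` only; the Yang–Mills mass gap (Clay) is NOT proved by any of
this; nothing continuum ∕ ℝ⁴ ∕ OS.
-/

noncomputable section

namespace Summit.QuantumFields.YangMills.BalabanUVNodes.N12RootTransporterBjLocalB

open Literature.MathematicalPhysics.QuantumFieldTheory.Balaban1983to89.B15DeterminingSetsB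

open scoped BigOperators
open Literature.MathematicalPhysics.QuantumFieldTheory.Balaban1983to89
open T4Continuum BlockAveraging
open B15DeterminingSets
open B5Eq118OneStroke (iterBlockOf)
open B14.Eq213MaximalDomains (side)
open B14.Eq213DetSet (Bj Bj_zero maxDomT)
open T4ForestGaugeCorridorBound (dist1_holAt_chain_mul_prod_inv_le dist1_prod_le_sum dist1_segRev_mul_iter_blockAvg_le)
open BlockAveragingTowerStraightTransportLocal (dist1_straight_mul_inv_iter_le_local)
open Summit.QuantumFields.YangMills.BalabanUVNodes.N12FlatHndRecordLetters (hcov_Bj)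
open Summit.QuantumFields.YangMills.BalabanUVNodes.N12BlockChains (length_flatten_le_of_forall_le)
open Summit.QuantumFields.YangMills.BalabanUVNodes.N12BjRootChains (exists_rootChain_Bj exists_chain_root_centre exists_chain_centre_centre)
open Summit.QuantumFields.YangMills.BalabanUVNodes.N12BjRootChainsGraded (exists_rootChain_Bj_graded)

section
variable {P : Params} {G : Type*} [GaugeGroup G]
open Summit.QuantumFields.YangMills.BalabanUVNodes.N12RootTransporterBj (theta_mono_of_nonneg)

/-- ★★ **THE TRANSPORTER DATUM OF A MEMBER CHAIN, LOCAL LETTER** — `N12RootTransporterBj.transporter_of_links` with the member-average letter `dist1 (M^i(U)(c)) ≤ δ₁` asked ONLY for members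
`c` one of whose segment ends `ι_i c∓` is reached from the chain's root `r` by a fine word of length `≤ Rloc`, `Rloc ≥ (#links)·L^N` (the chain's consecutiveness supplies the word: the flattened
prefix).  [cite: Balaban1985Variational, (3)–(4) p.278, (16)–(18) p.280; Balaban1985Averaging, (19)–(20) p.21; Balaban1988Convergent, (2.13) pp.256–257] -/
theorem transporter_of_links_local (ℰ : LoopAverage G) (U : GaugeField P 0 G) (κ θ : ℕ → ℝ) (hθ0 : 0 ≤ θ 0) (hθ : ∀ i, κ i + P.L * θ i ≤ θ (i + 1))
    {k N : ℕ} (hθN : ∀ i ≤ N, θ i ≤ θ N) (𝔅 : BDetSet P)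
    (hκ : ∀ i ≤ k, ∀ c ∈ (𝔅 i), ∀ i' < i, ∀ c' : PBond P (i' + 1), c'.dir = c.dir →
      (∃ t < P.L ^ i, embIter (i' + 1) c'.src = (fun z : Site P 0 => z.shift c.dir)^[t] (embIter i c.src)) →
      dist1 (corr ℰ (Averaging.iter (fun i => blockAvg (P := P) (j := i) ℰ) i' U) c') ≤ κ i')
    (r : Site P 0) (links : List ((m : ℕ) × (PBond P m × Bool)))
    (hmem : ∀ l ∈ links, l.1 ≤ k ∧ l.2.1 ∈ (𝔅 l.1)) (hmemN : ∀ l ∈ links, l.1 ≤ N)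
    (hcons : ∀ (pre post : List ((m : ℕ) × (PBond P m × Bool))) (l : (m : ℕ) × (PBond P m × Bool)), links = pre ++ l :: post →
      (l.2.2 = true → walkEnd r (pre.map fun l => List.replicate (P.L ^ l.1) (l.2.1.dir, l.2.2)).flatten = embIter l.1 l.2.1.src) ∧
      (l.2.2 = false → walkEnd r (pre.map fun l => List.replicate (P.L ^ l.1) (l.2.1.dir, l.2.2)).flatten = embIter l.1 l.2.1.tgt))
    -- LOCAL member-average letter: only members reachable from `r` by a fine word of length `≤ Rloc` are read
    {δ₁ : ℝ} {Rloc : ℕ} (hR : links.length * P.L ^ N ≤ Rloc)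
    (hδ₁ : ∀ i ≤ k, ∀ c ∈ (𝔅 i), (∃ w : List (Letter P.d), w.length ≤ Rloc ∧ (walkEnd r w = embIter i c.src ∨ walkEnd r w = embIter i c.tgt)) →
      dist1 (Averaging.iter (fun i => blockAvg (P := P) (j := i) ℰ) i U c) ≤ δ₁) :
    ∃ g : G, dist1 (holAt U (walk r (links.map fun l => List.replicate (P.L ^ l.1) (l.2.1.dir, l.2.2)).flatten) * g⁻¹) ≤ links.length * θ N ∧
      dist1 g ≤ links.length * δ₁ ∧
      ((links.map fun l => List.replicate (P.L ^ l.1) (l.2.1.dir, l.2.2)).flatten).length ≤ links.length * P.L ^ N := by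
  classical
  -- the links as (word, element, budget) triples
  set M : (m : ℕ) × (PBond P m × Bool) → G := fun l => Averaging.iter (fun i => blockAvg (P := P) (j := i) ℰ) l.1 U l.2.1 with hM
  set τ : (m : ℕ) × (PBond P m × Bool) → List (Letter P.d) × G × ℝ :=
    fun l => (List.replicate (P.L ^ l.1) (l.2.1.dir, l.2.2), (if l.2.2 then M l else (M l)⁻¹), θ l.1) with hτ
  have hfst : (links.map τ).map Prod.fst = links.map fun l => List.replicate (P.L ^ l.1) (l.2.1.dir, l.2.2) := by
    rw [List.map_map]; rfl
  -- the per-link transporter letter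
  have hlinks : ∀ (pre post : List (List (Letter P.d) × G × ℝ)) (link : List (Letter P.d) × G × ℝ), links.map τ = pre ++ link :: post →
      dist1 (holAt U (walk (walkEnd r (pre.map Prod.fst).flatten) link.1) * (link.2.1)⁻¹) ≤ link.2.2 := by
    intro pre post link h
    obtain ⟨pre₀, rest, hsplit, hpre, hrest⟩ := List.map_eq_append_iff.mp h
    obtain ⟨l₀, post₀, hrest', hl, -⟩ := List.map_eq_cons_iff.mp hrest
    subst hl
    rw [hrest'] at hsplit
    obtain ⟨hl₀k, hl₀mem⟩ := hmem l₀ (by rw [hsplit]; simp)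
    have hpre' : (pre.map Prod.fst).flatten = (pre₀.map fun l => List.replicate (P.L ^ l.1) (l.2.1.dir, l.2.2)).flatten := by
      rw [← hpre, List.map_map]; rfl
    have hst := hcons pre₀ post₀ l₀ hsplit
    have hκ₀ := hκ l₀.1 hl₀k l₀.2.1 hl₀mem
    rw [hpre']
    cases h2 : l₀.2.2
    · -- backward: from `ι c₊` along `(−e_dir)^{L^i}` versus `M(c)⁻¹`
      rw [hst.2 h2]
      have hseg : (τ l₀).1 = wordRev (List.replicate (P.L ^ l₀.1) (l₀.2.1.dir, true)) := by
        show List.replicate (P.L ^ l₀.1) (l₀.2.1.dir, l₀.2.2) = _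
        unfold wordRev
        rw [List.map_replicate, List.reverse_replicate, h2]
        rfl
      have hg : (τ l₀).2.1 = (M l₀)⁻¹ := by show (if l₀.2.2 then M l₀ else (M l₀)⁻¹) = _; rw [h2]; rfl
      rw [hseg, hg]
      exact dist1_segRev_mul_iter_blockAvg_le ℰ U κ θ hθ0 hθ l₀.1 l₀.2.1 hκ₀
    · -- forward: from `ι c₋` along `(+e_dir)^{L^i}` versus `M(c)`
      rw [hst.1 h2]
      have hseg : (τ l₀).1 = List.replicate (P.L ^ l₀.1) (l₀.2.1.dir, true) := by
        show List.replicate (P.L ^ l₀.1) (l₀.2.1.dir, l₀.2.2) = _; rw [h2]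
      have hg : (τ l₀).2.1 = M l₀ := by show (if l₀.2.2 then M l₀ else (M l₀)⁻¹) = _; rw [h2]; rfl
      rw [hseg, hg]
      exact dist1_straight_mul_inv_iter_le_local ℰ U κ θ hθ0 hθ l₀.1 l₀.2.1 hκ₀
  have hchain := dist1_holAt_chain_mul_prod_inv_le U (links.map τ) r hlinks
  rw [hfst] at hchain
  refine ⟨((links.map τ).map fun l => l.2.1).prod, hchain.trans ?_, (dist1_prod_le_sum _).trans ?_, ?_⟩
  · -- `Σ θ_{i_l} ≤ (#links)·θ_N`
    have h : ∀ x ∈ (links.map τ).map (fun l => l.2.2), x ≤ θ N := by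
      intro x hx
      obtain ⟨l, hl, rfl⟩ := List.mem_map.mp hx
      obtain ⟨l₀, hl₀, rfl⟩ := List.mem_map.mp hl
      exact hθN l₀.1 (hmemN l₀ hl₀)
    have := List.sum_le_card_nsmul _ (θ N) h
    rw [List.length_map, List.length_map, nsmul_eq_mul] at this
    exact this
  · -- `Σ dist1 g_l ≤ (#links)·δ₁`
    have h : ∀ x ∈ ((links.map τ).map fun l => l.2.1).map dist1, x ≤ δ₁ := by
      intro x hx
      obtain ⟨g, hg, rfl⟩ := List.mem_map.mp hx
      obtain ⟨l, hl, rfl⟩ := List.mem_map.mp hg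
      obtain ⟨l₀, hl₀, rfl⟩ := List.mem_map.mp hl
      obtain ⟨s, t, hst⟩ := List.append_of_mem hl₀
      have hcst := hcons s t l₀ hst
      have hlenS : ((s.map fun l => List.replicate (P.L ^ l.1) (l.2.1.dir, l.2.2)).flatten).length ≤ Rloc := by
        refine le_trans (length_flatten_le_of_forall_le _ s fun l hl => ?_) (le_trans (Nat.mul_le_mul_right _ ?_) hR)
        · rw [List.length_replicate]; exact Nat.pow_le_pow_right P.L_pos (hmemN l (by rw [hst]; simp [hl]))
        · have := congrArg List.length hst; simp only [List.length_append, List.length_cons] at this; omega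
      have hd := hδ₁ l₀.1 (hmem l₀ hl₀).1 l₀.2.1 (hmem l₀ hl₀).2 ⟨_, hlenS, by
        cases h2 : l₀.2.2
        · exact Or.inr (hcst.2 h2)
        · exact Or.inl (hcst.1 h2)⟩
      show dist1 (if l₀.2.2 then M l₀ else (M l₀)⁻¹) ≤ δ₁
      split_ifs
      · exact hd
      · rw [GaugeGroup.dist1_inv]; exact hd
    have := List.sum_le_card_nsmul _ δ₁ h
    rw [List.length_map, List.length_map, List.length_map, nsmul_eq_mul] at this
    exact this
  · -- total length
    refine length_flatten_le_of_forall_le _ links fun l hl => ?_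
    rw [List.length_replicate]
    exact Nat.pow_le_pow_right P.L_pos (hmemN l hl)

end

end Summit.QuantumFields.YangMills.BalabanUVNodes.N12RootTransporterBjLocalB

end
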